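import Mathlib
import Summits.ValiantsHypothesis.ValiantsHypothesis.Theorems.NNDivisionHard.Negative.LocatedPencilLawFalseLayer

/-!
# KILL NOTE N22, kernel part 4b — peeling the layer cake (crux `FifoMatching.NNDivisionHard`,
# stmt-ValiantsHypothesis-21181; Negative lane)
val-idea-crit-9 g2 (critic of record, WAVE 6).  `rep_Gfun`: for every row `a` and every real vector `v`
the diagonal slack function `Gfun a v` of `…Layer` lies in the cone `Rep` spanned by the poly(n) column
functions.  Induction on `Nv v` (number of values outside `{0,1}`): `step_up` lowers a top plateau `> 1`,
`step_down` raises a bottom plateau `< 0`, `step_mid` interpolates an inner plateau between its neighbours,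
`rep_of_01` is the vertex case (`vertex_identity`).  Theorems only; VP ≠ VNP is NOT proved; the crux stays OPEN.
-/

namespace Summit.ValiantsHypothesis.Theorems.NNDivisionHardNegative.LocatedPencil

open Matrix Finset
open Summit.ValiantsHypothesis.ValiantsHypothesis.Theorems.FifoMatching.XcDivision (udInd udInd_apply)
open Summit.ValiantsHypothesis.Theorems.NNDivisionHardNegative.DiagTilted (udInd_nonneg' udInd_le_one')

noncomputable section

variable {n : ℕ}

/-- `λ ≥ 0`. -/
theorem lam_nonneg : 0 ≤ lam n := by unfold lam; positivity

/-- the largest value of `v` below `h₁`, floored at `f₀ < h₁`. -/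
theorem exists_next_below (v : Fin n → ℝ) (h₁ f₀ : ℝ) (hf : f₀ < h₁) :
    ∃ h₂ : ℝ, f₀ ≤ h₂ ∧ h₂ < h₁ ∧ (∀ j, v j < h₁ → v j ≤ h₂) ∧ (h₂ = f₀ ∨ ∃ j, v j = h₂ ∧ h₂ < h₁) := by
  by_cases hne : (Finset.univ.filter fun j => v j < h₁).Nonempty
  · obtain ⟨j₀, hj₀, hmax⟩ := Finset.exists_max_image _ v hne
    have hj₀' : v j₀ < h₁ := (Finset.mem_filter.1 hj₀).2
    refine ⟨max f₀ (v j₀), le_max_left _ _, max_lt hf hj₀', fun j hj => ?_, ?_⟩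
    · exact (hmax j (Finset.mem_filter.2 ⟨Finset.mem_univ _, hj⟩)).trans (le_max_right _ _)
    · rcases le_total f₀ (v j₀) with h | h
      · exact Or.inr ⟨j₀, (max_eq_right h).symm, by rw [max_eq_right h]; exact hj₀'⟩
      · exact Or.inl (max_eq_left h)
  · refine ⟨f₀, le_rfl, hf, fun j hj => ?_, Or.inl rfl⟩
    exact absurd ⟨j, Finset.mem_filter.2 ⟨Finset.mem_univ _, hj⟩⟩ hne

/-- the smallest value of `v` above `ℓ₁`, capped at `c₀ > ℓ₁`. -/
theorem exists_next_above (v : Fin n → ℝ) (ℓ₁ c₀ : ℝ) (hc : ℓ₁ < c₀) :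
    ∃ ℓ₂ : ℝ, ℓ₂ ≤ c₀ ∧ ℓ₁ < ℓ₂ ∧ (∀ j, ℓ₁ < v j → ℓ₂ ≤ v j) ∧ (ℓ₂ = c₀ ∨ ∃ j, v j = ℓ₂ ∧ ℓ₁ < ℓ₂) := by
  by_cases hne : (Finset.univ.filter fun j => ℓ₁ < v j).Nonempty
  · obtain ⟨j₀, hj₀, hmin⟩ := Finset.exists_min_image _ v hne
    have hj₀' : ℓ₁ < v j₀ := (Finset.mem_filter.1 hj₀).2
    refine ⟨min c₀ (v j₀), min_le_left _ _, lt_min hc hj₀', fun j hj => ?_, ?_⟩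
    · exact (min_le_right _ _).trans (hmin j (Finset.mem_filter.2 ⟨Finset.mem_univ _, hj⟩))
    · rcases le_total (v j₀) c₀ with h | h
      · exact Or.inr ⟨j₀, (min_eq_right h).symm, by rw [min_eq_right h]; exact hj₀'⟩
      · exact Or.inl (min_eq_left h)
  · refine ⟨c₀, le_rfl, hc, fun j hj => ?_, Or.inl rfl⟩
    exact absurd ⟨j, Finset.mem_filter.2 ⟨Finset.mem_univ _, hj⟩⟩ hne

/-- base: a `{0,1}`-valued `v` is a vertex row, represented by `vertex_identity`. -/
theorem rep_of_01 (a : Finset (Fin n)) (v : Fin n → ℝ) (h : ∀ i, v i = 0 ∨ v i = 1) : Rep (Gfun a v) := by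
  obtain ⟨c, hc⟩ : ∃ c : Finset (Fin n), v = udInd c := by
    refine ⟨plateau v 1, funext fun i => ?_⟩
    rw [udInd_apply]
    rcases h i with h0 | h1
    · rw [if_neg (fun hi => by have := mem_plateau.1 hi; rw [h0] at this; exact zero_ne_one this), h0]
    · rw [if_pos (mem_plateau.2 h1), h1]
  subst hc
  refine (rep_base a c).congr fun b π => ?_
  unfold Gfun
  rw [pval_sub_pmin_udInd]
  exact vertex_identity a c b π

/-- peel-up: lower the top plateau (value `> 1`) to the next value below, floored at `1`. -/
theorem step_up (a : Finset (Fin n)) (v : Fin n → ℝ) (hup : ∃ i, 1 < v i) :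
    ∃ v' : Fin n → ℝ, Nv v' < Nv v ∧ (Rep (Gfun a v') → Rep (Gfun a v)) := by
  obtain ⟨i₁, hi₁⟩ := hup
  obtain ⟨i₀, -, hmax⟩ := Finset.exists_max_image Finset.univ v ⟨i₁, Finset.mem_univ _⟩
  have hmax' : ∀ j, v j ≤ v i₀ := fun j => hmax j (Finset.mem_univ _)
  have h1 : 1 < v i₀ := lt_of_lt_of_le hi₁ (hmax' i₁)
  obtain ⟨h₂, h2ge, h12, hlo, ht⟩ := exists_next_below v (v i₀) 1 h1
  refine ⟨setOn v (plateau v (v i₀)) h₂, Nv_setOn_lt v (v i₀) h₂ ⟨i₀, rfl⟩ (by linarith) (ne_of_gt h1)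
    (ht.elim (fun h => Or.inr (Or.inl h)) fun ⟨j, hj, hj'⟩ => Or.inr (Or.inr ⟨j, hj, ne_of_lt hj'⟩)), fun hrep => ?_⟩
  obtain ⟨π₀, hπ₀⟩ := exists_antivary v
  have hCv : setOn v (plateau v (v i₀)) (v i₀) = v := setOn_plateau v (v i₀)
  have hs : Antivary (setOn v (plateau v (v i₀)) h₂) (rk π₀) :=
    antivary_of_imp hπ₀ (setOn_mono v (v i₀) h₂ hlo (fun j hj => absurd (hmax' j) (not_le.2 hj)))
  have htop : Antivary (setOn v (plateau v (v i₀)) (v i₀)) (rk π₀) := by rw [hCv]; exact hπ₀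
  have hCav : Antivary (udInd (plateau v (v i₀))) (rk π₀) :=
    antivary_of_imp hπ₀ (udInd_plateau_max_mono v (v i₀) hmax')
  have hbr : ∀ i ∈ plateau v (v i₀), (i ∈ plateau v (v i₀) → udInd a i ≤ h₂ ∧ udInd a i ≤ v i₀)
      ∧ (i ∉ plateau v (v i₀) → h₂ ≤ udInd a i ∧ v i₀ ≤ udInd a i) :=
    fun i hi => ⟨fun _ => ⟨(udInd_le_one' a i).trans h2ge, (udInd_le_one' a i).trans (h2ge.trans h12.le)⟩,
      fun h => absurd hi h⟩
  have key : ∀ b π, Gfun a v b π = Gfun a (setOn v (plateau v (v i₀)) h₂) b π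
      + (v i₀ - h₂) * ((∑ i ∈ plateau v (v i₀), (1 - udInd b i)) + lam n * inv (plateau v (v i₀)) π) := by
    intro b π
    have hd := core_diff a v _ _ h₂ (v i₀) π₀ hs htop hbr b π
    rw [hCv] at hd
    have hray : (∑ i ∈ plateau v (v i₀), if i ∈ plateau v (v i₀) then 1 - udInd b i else -udInd b i)
        = ∑ i ∈ plateau v (v i₀), (1 - udInd b i) := Finset.sum_congr rfl fun i hi => if_pos hi
    have hpm : pval (udInd (plateau v (v i₀))) π - pval (udInd (plateau v (v i₀))) π₀
        = inv (plateau v (v i₀)) π := by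
      rw [← pmin_eq_of_antivary hCav]; exact pval_sub_pmin_udInd _ π
    rw [hray, hpm] at hd
    linear_combination hd
  exact (hrep.add (((rep_raySub _).add ((rep_inv _).smul lam_nonneg)).smul (sub_nonneg.2 h12.le))).congr key

/-- peel-down: raise the bottom plateau (value `< 0`) to the next value above, capped at `0`. -/
theorem step_down (a : Finset (Fin n)) (v : Fin n → ℝ) (hdown : ∃ i, v i < 0) :
    ∃ v' : Fin n → ℝ, Nv v' < Nv v ∧ (Rep (Gfun a v') → Rep (Gfun a v)) := by
  obtain ⟨i₁, hi₁⟩ := hdown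
  obtain ⟨i₀, -, hmin⟩ := Finset.exists_min_image Finset.univ v ⟨i₁, Finset.mem_univ _⟩
  have hmin' : ∀ j, v i₀ ≤ v j := fun j => hmin j (Finset.mem_univ _)
  have h0 : v i₀ < 0 := lt_of_le_of_lt (hmin' i₁) hi₁
  obtain ⟨ℓ₂, h2le, h12, hhi, ht⟩ := exists_next_above v (v i₀) 0 h0
  refine ⟨setOn v (plateau v (v i₀)) ℓ₂, Nv_setOn_lt v (v i₀) ℓ₂ ⟨i₀, rfl⟩ (ne_of_lt h0) (by linarith)
    (ht.elim (fun h => Or.inl h) fun ⟨j, hj, hj'⟩ => Or.inr (Or.inr ⟨j, hj, ne_of_gt hj'⟩)), fun hrep => ?_⟩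
  obtain ⟨π₀, hπ₀⟩ := exists_antivary v
  have hCv : setOn v (plateau v (v i₀)) (v i₀) = v := setOn_plateau v (v i₀)
  have hs : Antivary (setOn v (plateau v (v i₀)) ℓ₂) (rk π₀) :=
    antivary_of_imp hπ₀ (setOn_mono v (v i₀) ℓ₂ (fun j hj => absurd (hmin' j) (not_le.2 hj)) hhi)
  have htop : Antivary (setOn v (plateau v (v i₀)) (v i₀)) (rk π₀) := by rw [hCv]; exact hπ₀
  have hCav : Antivary (udInd (plateau v (v i₀))ᶜ) (rk π₀) :=
    antivary_of_imp hπ₀ (udInd_plateau_min_compl_mono v (v i₀) hmin')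
  have hbr : ∀ i ∈ plateau v (v i₀), (i ∈ (∅ : Finset (Fin n)) → udInd a i ≤ ℓ₂ ∧ udInd a i ≤ v i₀)
      ∧ (i ∉ (∅ : Finset (Fin n)) → ℓ₂ ≤ udInd a i ∧ v i₀ ≤ udInd a i) :=
    fun i _ => ⟨fun h => absurd h (Finset.notMem_empty i),
      fun _ => ⟨h2le.trans (udInd_nonneg' a i), (h0.le).trans (udInd_nonneg' a i)⟩⟩
  have key : ∀ b π, Gfun a v b π = Gfun a (setOn v (plateau v (v i₀)) ℓ₂) b π
      + (ℓ₂ - v i₀) * ((∑ i ∈ plateau v (v i₀), udInd b i) + lam n * inv (plateau v (v i₀))ᶜ π) := by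
    intro b π
    have hd := core_diff a v _ ∅ ℓ₂ (v i₀) π₀ hs htop hbr b π
    rw [hCv] at hd
    have hray : (∑ i ∈ plateau v (v i₀), if i ∈ (∅ : Finset (Fin n)) then 1 - udInd b i else -udInd b i)
        = -∑ i ∈ plateau v (v i₀), udInd b i := by
      rw [← Finset.sum_neg_distrib]
      exact Finset.sum_congr rfl fun i _ => if_neg (Finset.notMem_empty i)
    have e1 := pval_compl (plateau v (v i₀)) π
    have e2 := pval_compl (plateau v (v i₀)) π₀
    have e3 := pval_sub_pmin_udInd (plateau v (v i₀))ᶜ π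
    rw [pmin_eq_of_antivary hCav] at e3
    rw [hray] at hd
    linear_combination hd + (v i₀ - ℓ₂) * lam n * (e1 - e2 - e3)
  exact (hrep.add (((rep_rayInd _).add ((rep_inv _).smul lam_nonneg)).smul (sub_nonneg.2 h12.le))).congr key

/-- peel-mid: all values in `[0,1]`, some strictly inside — interpolate the top inner plateau between its
neighbours (floored at `0`, capped at `1`). -/
theorem step_mid (a : Finset (Fin n)) (v : Fin n → ℝ) (h01 : ∀ i, 0 ≤ v i ∧ v i ≤ 1)
    (hmid : ∃ i, v i ≠ 0 ∧ v i ≠ 1) :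
    ∃ v₀ v₁ : Fin n → ℝ, Nv v₀ < Nv v ∧ Nv v₁ < Nv v ∧ (Rep (Gfun a v₀) → Rep (Gfun a v₁) → Rep (Gfun a v)) := by
  obtain ⟨i₁, hi₁0, hi₁1⟩ := hmid
  have hi₁lt : v i₁ < 1 := lt_of_le_of_ne (h01 i₁).2 hi₁1
  have hi₁pos : 0 < v i₁ := lt_of_le_of_ne (h01 i₁).1 (Ne.symm hi₁0)
  obtain ⟨i₀, hi₀, hmax⟩ := Finset.exists_max_image (Finset.univ.filter fun j => v j < 1) v
    ⟨i₁, Finset.mem_filter.2 ⟨Finset.mem_univ _, hi₁lt⟩⟩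
  have h1lt : v i₀ < 1 := (Finset.mem_filter.1 hi₀).2
  have hlo1 : ∀ j, v j < 1 → v j ≤ v i₀ := fun j hj => hmax j (Finset.mem_filter.2 ⟨Finset.mem_univ _, hj⟩)
  have h1pos : 0 < v i₀ := lt_of_lt_of_le hi₁pos (hlo1 i₁ hi₁lt)
  have hhi1 : ∀ j, v i₀ < v j → v j = 1 := fun j hj => by
    by_contra hne
    exact absurd (hlo1 j (lt_of_le_of_ne (h01 j).2 hne)) (not_le.2 hj)
  obtain ⟨h₂, h2ge, h12, hlo2, ht⟩ := exists_next_below v (v i₀) 0 h1pos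
  refine ⟨setOn v (plateau v (v i₀)) h₂, setOn v (plateau v (v i₀)) 1,
    Nv_setOn_lt v (v i₀) h₂ ⟨i₀, rfl⟩ (ne_of_gt h1pos) (ne_of_lt h1lt)
      (ht.elim (fun h => Or.inl h) fun ⟨j, hj, hj'⟩ => Or.inr (Or.inr ⟨j, hj, ne_of_lt hj'⟩)),
    Nv_setOn_lt v (v i₀) 1 ⟨i₀, rfl⟩ (ne_of_gt h1pos) (ne_of_lt h1lt) (Or.inr (Or.inl rfl)),
    fun hrep₀ hrep₁ => ?_⟩
  obtain ⟨π₀, hπ₀⟩ := exists_antivary v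
  have hCv : setOn v (plateau v (v i₀)) (v i₀) = v := setOn_plateau v (v i₀)
  have hs0 : Antivary (setOn v (plateau v (v i₀)) h₂) (rk π₀) :=
    antivary_of_imp hπ₀ (setOn_mono v (v i₀) h₂ hlo2 (fun j hj => by linarith))
  have hs1 : Antivary (setOn v (plateau v (v i₀)) 1) (rk π₀) :=
    antivary_of_imp hπ₀ (setOn_mono v (v i₀) 1 (fun j _ => (h01 j).2) (fun j hj => (hhi1 j hj).symm.le))
  have htop : Antivary (setOn v (plateau v (v i₀)) (v i₀)) (rk π₀) := by rw [hCv]; exact hπ₀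
  have hbr : ∀ t : ℝ, 0 ≤ t → t ≤ 1 → ∀ i ∈ plateau v (v i₀),
      (i ∈ plateau v (v i₀) \ a → udInd a i ≤ h₂ ∧ udInd a i ≤ t)
      ∧ (i ∉ plateau v (v i₀) \ a → h₂ ≤ udInd a i ∧ t ≤ udInd a i) := by
    intro t ht0 ht1 i hi
    constructor
    · intro h
      rw [udInd_apply, if_neg (Finset.mem_sdiff.1 h).2]
      exact ⟨h2ge, ht0⟩
    · intro h
      have hia : i ∈ a := by
        by_contra hia; exact h (Finset.mem_sdiff.2 ⟨hi, hia⟩)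
      rw [udInd_apply, if_pos hia]
      exact ⟨by linarith, ht1⟩
  have key : ∀ b π, Gfun a v b π = (1 - v i₀) / (1 - h₂) * Gfun a (setOn v (plateau v (v i₀)) h₂) b π
      + (v i₀ - h₂) / (1 - h₂) * Gfun a (setOn v (plateau v (v i₀)) 1) b π := by
    intro b π
    have d₁ := core_diff a v _ (plateau v (v i₀) \ a) h₂ (v i₀) π₀ hs0 htop (hbr _ h1pos.le h1lt.le) b π
    have d₂ := core_diff a v _ (plateau v (v i₀) \ a) h₂ 1 π₀ hs0 hs1 (hbr 1 zero_le_one le_rfl) b π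
    rw [hCv] at d₁
    rw [div_mul_eq_mul_div, div_mul_eq_mul_div, ← add_div, eq_div_iff (by linarith : (1 - h₂ : ℝ) ≠ 0)]
    linear_combination (1 - h₂) * d₁ - (v i₀ - h₂) * d₂
  exact ((hrep₀.smul (div_nonneg (by linarith) (by linarith))).add
    (hrep₁.smul (div_nonneg (by linarith) (by linarith)))).congr key

/-- the layer cake, by strong induction on `Nv`. -/
theorem rep_Gfun_aux (a : Finset (Fin n)) : ∀ N : ℕ, ∀ v : Fin n → ℝ, Nv v = N → Rep (Gfun a v) := by
  intro N
  induction N using Nat.strong_induction_on with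
  | _ N ih =>
    intro v hv
    by_cases hup : ∃ i, 1 < v i
    · obtain ⟨v', hlt, himp⟩ := step_up a v hup
      exact himp (ih (Nv v') (hv ▸ hlt) v' rfl)
    by_cases hdown : ∃ i, v i < 0
    · obtain ⟨v', hlt, himp⟩ := step_down a v hdown
      exact himp (ih (Nv v') (hv ▸ hlt) v' rfl)
    push Not at hup hdown
    have h01 : ∀ i, 0 ≤ v i ∧ v i ≤ 1 := fun i => ⟨hdown i, hup i⟩
    by_cases hmid : ∃ i, v i ≠ 0 ∧ v i ≠ 1
    · obtain ⟨v₀, v₁, h0, h1, himp⟩ := step_mid a v h01 hmid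
      exact himp (ih _ (hv ▸ h0) v₀ rfl) (ih _ (hv ▸ h1) v₁ rfl)
    · push Not at hmid
      exact rep_of_01 a v fun i => (eq_or_ne (v i) 0).imp_right (hmid i)

/-- **Layer cake.** The diagonal slack function of every real diagonal tilt of every row is a nonnegative
combination of the `|DSlot n| = poly(n)` column functions `dcolV`. -/
theorem rep_Gfun (a : Finset (Fin n)) (v : Fin n → ℝ) : Rep (Gfun a v) := rep_Gfun_aux a (Nv v) v rfl

end

end Summit.ValiantsHypothesis.Theorems.NNDivisionHardNegative.LocatedPencil
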